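import Literature.AlgebraicGeometry.Motives.HodgeStructureLefschetzSimilitudeGroupCenterPoints
import Literature.AlgebraicGeometry.Motives.HodgeStructureExtendedLefschetzGroupPoints
import HarnessLib

/-!
# «THE KERNEL OF `l(A)` … EQUALS `S(A)`», «`a ↦ (a⁻¹, a⁻²) : 𝔾_m → L(A)` … `l ∘ w = −2`» ON `K`-POINTS:
# `K^× · 1 ∩ S(H)(K) = μ₂(K)`, AND WHEN THE MULTIPLIERS ARE SQUARES (E.G. `K` ALGEBRAICALLY CLOSED)
# `G(H)(K) = K^× · S(H)(K)` AND `Z(G(H)(K)) = K^× · Z(S(H)(K))`, UNIQUELY UP TO `±1` (Milne 1999 §4 p. 659)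

[topic AlgebraicGeometry/Motives]

Layer `Literature/AlgebraicGeometry/Motives`, lane `lit-hodgefound` (Track 2 foundations library; prover seat
`lit-hodgefound-p02`, generation 57, self-proposed row g57-#3; successor-menu item (i) of generation 56, RE-BASED on the tree's
`Polarization.lefschetzMultiplier` ∕ `Polarization.smulOfUnit_inv_mul_mem_lefschetzGroupBaseChange`
(`Motives/HodgeStructureExtendedLefschetzGroupPoints`) instead of restating the multiplier). THEOREMS ONLY: no definition, no named
fact (net debt `0`), no instance, no notation.

Milne §4 (p. 659): `G(A)(R) = {γ ∈ C(A) ⊗ R | γ†γ ∈ R^×}`, Theorem 4.4 `γ ↦ (γ, γ†γ) : G(A) ≅ L(A)`, «the kernel of `l(A)`,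
regarded as a subgroup of `GL(V(A))`, equals `S(A)`», and «the homomorphism `a ↦ (a⁻¹, a⁻²) : 𝔾_m → GL(V(A)) × 𝔾_m` takes values
in `L(A)`. Therefore `L(A)` has a canonical cocharacter `w`. Note that `l ∘ w = −2`.»  Consequently, over any field on whose points
`l` takes only SQUARE values (every algebraically closed `K`; or any `K` when `V` has a Hodge vector, the tree's
`Polarization.isSquare_lefschetzMultiplier_of_hodgeClasses_ne_bot`), `G(A)(K) = K^× · S(A)(K)`: for `γ ∈ G(H)(K)` with
`l(γ) = d²`, `d⁻¹γ ∈ Ker l = S(H)(K)` (the tree's `smulOfUnit_inv_mul_mem_lefschetzGroupBaseChange`), and `w(𝔾_m) ∩ S = μ₂`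
(`l ∘ w = −2`).  The tree has the MT∕Hg analogue («`MT(H)(L) = L^× · Hg(H)(L)`», `Motives/HodgeGroupKernelMultiplierCharacterSign`)
and, for `S ≤ G`, the centre dictionary `Z(S(H)(K)) = S(H)(K) ∩ Z(G(H)(K))`, `K^× · 1 ⊆ Z(G(H)(K))` (g56-#8).  PROVED here, for
every polarized `ℚ`-Hodge structure `(H, ψ)` on a finite-dimensional `V ≠ 0` and every field `K ⊇ ℚ`:
(i) **`a · 1 ∈ S(H)(K) ⟺ a² = 1 ⟺ a = ±1`** (`l(a · 1) = a²`): `K^× · 1 ∩ S(H)(K) = μ₂(K)`;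
(ii) `d · δ ∈ G(H)(K)` with `l(d · δ) = d²` for `d ∈ K^×`, `δ ∈ S(H)(K)`; conversely **every `γ ∈ G(H)(K)` WITH SQUARE MULTIPLIER
is `d · δ`**, `δ ∈ S(H)(K)`, `l(γ) = d²`; so if all multipliers are squares (e.g. `K` algebraically closed)
**`G(H)(K) = K^× · S(H)(K)`**, i.e. `γ ∈ G(H)(K) ⟺ ∃ d δ, δ ∈ S(H)(K) ∧ γ = d · δ`;
(iii) UNIQUENESS UP TO SIGN: `d · δ = d' · δ'` with `δ, δ' ∈ S(H)(K)` forces `d' = ±d` (and `δ' = ±δ`);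
(iv) THE CENTRE: `d · δ` is central in `G(H)(K)` iff `δ` is central in `S(H)(K)`; hence for central `γ` with square multiplier
`γ = d · δ` with `δ ∈ Z(S(H)(K))` — **`Z(G(H)(K)) = K^× · Z(S(H)(K))`** when all multipliers are squares (with g56-#10: in the first
kind over `K = K̄`, `Z(G(H)(K̄)) = K̄^× · {±1}^{t_{K̄}}`).

## The source, verbatim

J. S. Milne, *Lefschetz classes on abelian varieties*, Duke Math. J. **96** (1999) 639–675 [Milne1999LefschetzClasses] (held
`paper:doi-10-1215-s0012-7094-99-09620-5`; Duke page = folio + 638), p. 659 (p0021) L8–L14: «Let `G(A)` be the algebraic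
subgroup of `GL(V(A))` such that `G(A)(R) = {γ ∈ C(A) ⊗ R | γ†γ ∈ R^×}` for any `k`-algebra `R`. … **Theorem 4.4.** The map
`γ ↦ (γ, γ†γ) : G(A) → GL(V(A)) × 𝔾_m` sends `G(A)` isomorphically onto `L(A)`.»; L28–L34: «The projection map
`GL(V(A)) × 𝔾_m → 𝔾_m` defines a cocharacter of `L(A)`, which we denote `l(A)` (or just `l`). The theorem shows that the kernel
of `l(A)`, regarded as a subgroup of `GL(V(A))`, equals `S(A)`. It is clear from the theorem that the homomorphism
`a ↦ (a⁻¹, a⁻²) : 𝔾_m → GL(V(A)) × 𝔾_m` takes values in `L(A)`. Therefore `L(A)` has a canonical cocharacter `w`. Note that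
`l ∘ w = −2`.»; p. 660 (Proposition 4.8, proof): the exact sequence `0 → S(A) → L(A) → 𝔾_m → 0`.

## Dictionary and what is PROVED (namespace `Literature.AlgebraicGeometry.Motives.HodgeStructure`)

`G(H)(K) = ψ.lefschetzSimilitudeGroupBaseChange K`, `S(H)(K) = ψ.lefschetzGroupBaseChange K` (subgroups of `GL_K(K ⊗ V)`),
`l = ψ.lefschetzMultiplier K : G(H)(K) →* Kˣ`, `a · 1 = LinearEquiv.smulOfUnit a`, `Z(·) = Subgroup.center`.

* §1 scalars: **`Polarization.smulOfUnit_mem_lefschetzGroupBaseChange_iff`** (`a · 1 ∈ S ⟺ a * a = 1`),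
  **`Polarization.smulOfUnit_mem_lefschetzGroupBaseChange_iff_eq_or_eq_neg`** (`⟺ a = 1 ∨ a = −1`),
  `Polarization.smulOfUnit_neg_one_mem_lefschetzGroupBaseChange`.
* §2 `G = K^× · S`: **`Polarization.smulOfUnit_mul_mem_lefschetzSimilitudeGroupBaseChange`**,
  **`Polarization.lefschetzMultiplier_smulOfUnit_mul`** (`l(d · δ) = d²`),
  **`Polarization.exists_eq_smulOfUnit_mul_of_isSquare_lefschetzMultiplier`**,
  **`Polarization.mem_lefschetzSimilitudeGroupBaseChange_iff_exists_of_forall_isSquare`**, **`…_of_isAlgClosed`**,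
  **`Polarization.eq_or_eq_neg_of_smulOfUnit_mul_eq`** (uniqueness up to sign).
* §3 the centre: **`Polarization.smulOfUnit_mul_mem_center_lefschetzSimilitudeGroupBaseChange_iff`**,
  **`Polarization.exists_eq_smulOfUnit_mul_of_mem_center_of_isSquare`** (`Z(G) = K^× · Z(S)` elementwise),
  **`Polarization.mem_center_lefschetzSimilitudeGroupBaseChange_iff_exists_of_forall_isSquare`**, **`…_of_isAlgClosed`**.

NOT here: `G(H)(K) ≠ K^× · S(H)(K)` in general over non-closed `K` (non-square multipliers occur, e.g. for CM elliptic curves over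
`ℚ`); the algebraic-group statement `L = w(𝔾_m) · S` as a quotient `(𝔾_m × S)/μ₂ ≅ L`.

Nearest tree results, BY NAME: `Polarization.lefschetzMultiplier`, `lefschetzMultiplier_smulOfUnit` (`l(a · 1) = a²`),
`lefschetzMultiplier_eq_one_iff` (`Ker l = S`), `smulOfUnit_inv_mul_mem_lefschetzGroupBaseChange`,
`mumfordTateGroupBaseChange_eq_lefschetzSimilitudeGroupBaseChange_of_eq` (`Motives/HodgeStructureExtendedLefschetzGroupPoints`);
`smulOfUnit_mem_lefschetzSimilitudeGroupBaseChange`, `lefschetzGroupBaseChange_le_lefschetzSimilitudeGroupBaseChange`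
(`Motives/HodgeStructureLefschetzGroupPoints`); g56-#8 `Polarization.mem_center_lefschetzGroupBaseChange_iff_inclusion_mem_center`,
`Polarization.smulOfUnit_mem_center_lefschetzSimilitudeGroupBaseChange`; `exists_smulOfUnit_mul_mem_hodgeGroupBaseChange_of_isSquare`
(`Motives/HodgeGroupKernelMultiplierCharacterSign`, the MT∕Hg analogue); `isSquare_lefschetzMultiplier_of_hodgeClasses_ne_bot`
(`Motives/HodgeStructureHodgeVectorBlockLefschetzSimilitudePoints`).

## References

* [Milne1999LefschetzClasses] J. S. Milne, *Lefschetz classes on abelian varieties*, Duke Math. J. 96 (1999) 639–675, §4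
  Theorem 4.4 and p. 659 L28–L34; Proposition 4.8 (p. 660).
-/

noncomputable section

open scoped TensorProduct

namespace Literature.AlgebraicGeometry.Motives

namespace HodgeStructure

universe u uK

variable {V : Type u} [AddCommGroup V] [Module ℚ V] {n : ℤ} {H : HodgeStructure V n}
variable (K : Type uK) [Field K] [Algebra ℚ K] (ψ : Polarization H) [Module.Finite ℚ V]

/-! ## §1 The scalars `K^× · 1` and `S(H)(K)`: `a · 1 ∈ S(H)(K) ⟺ a² = 1` -/

omit [Module.Finite ℚ V] in
/-- `(a · 1)(b · 1) = (ab) · 1` in `GL_K(K ⊗ V)`. [folklore] -/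
private theorem smulOfUnit_mul_smulOfUnit₅₇₃ (a b : Kˣ) :
    (LinearEquiv.smulOfUnit a * LinearEquiv.smulOfUnit b : (K ⊗[ℚ] V) ≃ₗ[K] (K ⊗[ℚ] V)) = LinearEquiv.smulOfUnit (a * b) :=
  LinearEquiv.ext fun x => (mul_smul (a : K) (b : K) x).symm

omit [Module.Finite ℚ V] in
/-- `(a · 1)((a⁻¹ · 1) γ) = γ`. [folklore] -/
private theorem smulOfUnit_mul_smulOfUnit_inv_mul₅₇₃ (a : Kˣ) (γ : (K ⊗[ℚ] V) ≃ₗ[K] (K ⊗[ℚ] V)) :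
    LinearEquiv.smulOfUnit a * (LinearEquiv.smulOfUnit a⁻¹ * γ) = γ := by
  rw [← mul_assoc, smulOfUnit_mul_smulOfUnit₅₇₃, mul_inv_cancel]
  exact LinearEquiv.ext fun x => one_smul K _

variable [Nontrivial V]

/-- **`a · 1 ∈ S(H)(K) ⟺ a² = 1`** (`V ≠ 0`): «the kernel of `l(A)` … equals `S(A)`» and `l(a · 1) = a²` («`l ∘ w = −2`») — the scalars
in Milne's `S(A)(K)` are exactly `μ₂(K)`. [cite: Milne1999LefschetzClasses, §4 p. 659 L28–L34] -/
theorem Polarization.smulOfUnit_mem_lefschetzGroupBaseChange_iff (a : Kˣ) :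
    LinearEquiv.smulOfUnit a ∈ ψ.lefschetzGroupBaseChange K ↔ a * a = 1 := by
  rw [← ψ.lefschetzMultiplier_smulOfUnit K a]
  exact (ψ.lefschetzMultiplier_eq_one_iff K
    ⟨LinearEquiv.smulOfUnit a, ψ.smulOfUnit_mem_lefschetzSimilitudeGroupBaseChange K a⟩).symm

/-- **`a · 1 ∈ S(H)(K) ⟺ a = 1 ∨ a = −1`**: `K^× · 1 ∩ S(H)(K) = {±1}`. [cite: Milne1999LefschetzClasses, §4 p. 659 L28–L34] -/
theorem Polarization.smulOfUnit_mem_lefschetzGroupBaseChange_iff_eq_or_eq_neg (a : Kˣ) :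
    LinearEquiv.smulOfUnit a ∈ ψ.lefschetzGroupBaseChange K ↔ a = 1 ∨ a = -1 := by
  rw [ψ.smulOfUnit_mem_lefschetzGroupBaseChange_iff K, ← Units.val_inj, ← Units.val_inj (a := a), ← Units.val_inj (a := a),
    Units.val_mul, Units.val_one, Units.val_neg, Units.val_one]
  exact mul_self_eq_one_iff

/-- `−1 ∈ S(H)(K)`. [cite: Milne1999LefschetzClasses, §4 p. 659 L28–L34] -/
theorem Polarization.smulOfUnit_neg_one_mem_lefschetzGroupBaseChange :
    LinearEquiv.smulOfUnit (-1) ∈ ψ.lefschetzGroupBaseChange K :=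
  (ψ.smulOfUnit_mem_lefschetzGroupBaseChange_iff_eq_or_eq_neg K (-1)).2 (Or.inr rfl)

/-! ## §2 `G(H)(K) = K^× · S(H)(K)` when the multipliers are squares -/

omit [Nontrivial V] [Module.Finite ℚ V] in
/-- **`d · δ ∈ G(H)(K)` for `d ∈ K^×`, `δ ∈ S(H)(K)`** (`K^× · 1 ≤ G`, `S ≤ G`). [cite: Milne1999LefschetzClasses, §4 p. 659 L28–L34] -/
theorem Polarization.smulOfUnit_mul_mem_lefschetzSimilitudeGroupBaseChange (d : Kˣ) {δ : (K ⊗[ℚ] V) ≃ₗ[K] (K ⊗[ℚ] V)}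
    (hδ : δ ∈ ψ.lefschetzGroupBaseChange K) : LinearEquiv.smulOfUnit d * δ ∈ ψ.lefschetzSimilitudeGroupBaseChange K :=
  (ψ.lefschetzSimilitudeGroupBaseChange K).mul_mem (ψ.smulOfUnit_mem_lefschetzSimilitudeGroupBaseChange K d)
    (ψ.lefschetzGroupBaseChange_le_lefschetzSimilitudeGroupBaseChange K hδ)

/-- **`l(d · δ) = d²`** for `d ∈ K^×`, `δ ∈ S(H)(K)` (`l` multiplicative, `l(d · 1) = d²`, `l(δ) = 1`). [cite: Milne1999LefschetzClasses, §4 p. 659 L28–L34] -/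
theorem Polarization.lefschetzMultiplier_smulOfUnit_mul (d : Kˣ) {δ : (K ⊗[ℚ] V) ≃ₗ[K] (K ⊗[ℚ] V)}
    (hδ : δ ∈ ψ.lefschetzGroupBaseChange K) :
    ψ.lefschetzMultiplier K ⟨LinearEquiv.smulOfUnit d * δ, ψ.smulOfUnit_mul_mem_lefschetzSimilitudeGroupBaseChange K d hδ⟩ =
      d * d := by
  have hmul : (⟨LinearEquiv.smulOfUnit d * δ, ψ.smulOfUnit_mul_mem_lefschetzSimilitudeGroupBaseChange K d hδ⟩ :
      ψ.lefschetzSimilitudeGroupBaseChange K) =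
      ⟨LinearEquiv.smulOfUnit d, ψ.smulOfUnit_mem_lefschetzSimilitudeGroupBaseChange K d⟩ *
        ⟨δ, ψ.lefschetzGroupBaseChange_le_lefschetzSimilitudeGroupBaseChange K hδ⟩ := rfl
  rw [hmul, map_mul, ψ.lefschetzMultiplier_smulOfUnit K d,
    (ψ.lefschetzMultiplier_eq_one_iff K ⟨δ, ψ.lefschetzGroupBaseChange_le_lefschetzSimilitudeGroupBaseChange K hδ⟩).2 hδ,
    mul_one]

/-- **EVERY `γ ∈ G(H)(K)` WITH SQUARE MULTIPLIER IS A SCALAR TIMES AN ELEMENT OF `S(H)(K)`**: `l(γ) = d²` ⟹ `γ = d · δ`, `δ = d⁻¹γ ∈ S(H)(K)`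
(the tree's `smulOfUnit_inv_mul_mem_lefschetzGroupBaseChange`) — «the kernel of `l(A)` … equals `S(A)`», «`l ∘ w = −2`».
[cite: Milne1999LefschetzClasses, §4 p. 659 L28–L34] -/
theorem Polarization.exists_eq_smulOfUnit_mul_of_isSquare_lefschetzMultiplier (γ : ψ.lefschetzSimilitudeGroupBaseChange K)
    (hsq : IsSquare (ψ.lefschetzMultiplier K γ)) :
    ∃ (d : Kˣ) (δ : (K ⊗[ℚ] V) ≃ₗ[K] (K ⊗[ℚ] V)), δ ∈ ψ.lefschetzGroupBaseChange K ∧ ψ.lefschetzMultiplier K γ = d * d ∧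
      (γ : (K ⊗[ℚ] V) ≃ₗ[K] (K ⊗[ℚ] V)) = LinearEquiv.smulOfUnit d * δ := by
  obtain ⟨d, hd⟩ := hsq
  refine ⟨d, LinearEquiv.smulOfUnit d⁻¹ * (γ : (K ⊗[ℚ] V) ≃ₗ[K] (K ⊗[ℚ] V)), ?_, hd, ?_⟩
  · refine ψ.smulOfUnit_inv_mul_mem_lefschetzGroupBaseChange K γ.2 fun x y => ?_
    rw [← hd]
    exact ψ.baseChange_form_lefschetzMultiplier K γ x y
  · rw [smulOfUnit_mul_smulOfUnit_inv_mul₅₇₃]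

/-- **`G(H)(K) = K^× · S(H)(K)` WHEN EVERY UNIT OF `K` IS A SQUARE**: `γ ∈ G(H)(K) ⟺ γ = d · δ` for some `d ∈ K^×`, `δ ∈ S(H)(K)` —
on such `K`-points the sequence `0 → S(A) → L(A) → 𝔾_m → 0` reads `L(A)(K) = w(K^×) · S(A)(K)`.
[cite: Milne1999LefschetzClasses, §4 p. 659 L28–L34 and Proposition 4.8 (proof, p. 660)] -/
theorem Polarization.mem_lefschetzSimilitudeGroupBaseChange_iff_exists_of_forall_isSquare (hsq : ∀ c : Kˣ, IsSquare c)
    (γ : (K ⊗[ℚ] V) ≃ₗ[K] (K ⊗[ℚ] V)) :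
    γ ∈ ψ.lefschetzSimilitudeGroupBaseChange K ↔
      ∃ (d : Kˣ) (δ : (K ⊗[ℚ] V) ≃ₗ[K] (K ⊗[ℚ] V)), δ ∈ ψ.lefschetzGroupBaseChange K ∧ γ = LinearEquiv.smulOfUnit d * δ := by
  constructor
  · intro hγ
    obtain ⟨d, δ, hδ, -, h⟩ := ψ.exists_eq_smulOfUnit_mul_of_isSquare_lefschetzMultiplier K ⟨γ, hγ⟩ (hsq _)
    exact ⟨d, δ, hδ, h⟩
  · rintro ⟨d, δ, hδ, rfl⟩
    exact ψ.smulOfUnit_mul_mem_lefschetzSimilitudeGroupBaseChange K d hδ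

/-- **`G(H)(K̄) = K̄^× · S(H)(K̄)` OVER AN ALGEBRAICALLY CLOSED FIELD** (Milne's groups are determined by their `k^{al}`-points).
[cite: Milne1999LefschetzClasses, §4 p. 659 L28–L34 and Proposition 4.8 (proof, p. 660)] -/
theorem Polarization.mem_lefschetzSimilitudeGroupBaseChange_iff_exists_of_isAlgClosed [IsAlgClosed K]
    (γ : (K ⊗[ℚ] V) ≃ₗ[K] (K ⊗[ℚ] V)) :
    γ ∈ ψ.lefschetzSimilitudeGroupBaseChange K ↔
      ∃ (d : Kˣ) (δ : (K ⊗[ℚ] V) ≃ₗ[K] (K ⊗[ℚ] V)), δ ∈ ψ.lefschetzGroupBaseChange K ∧ γ = LinearEquiv.smulOfUnit d * δ := by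
  refine ψ.mem_lefschetzSimilitudeGroupBaseChange_iff_exists_of_forall_isSquare K (fun c => ?_) γ
  obtain ⟨z, hz⟩ := IsAlgClosed.exists_eq_mul_self (c : K)
  have hz0 : z ≠ 0 := fun h => c.ne_zero (by rw [hz, h, mul_zero])
  exact ⟨Units.mk0 z hz0, Units.ext (by rw [Units.val_mul, Units.val_mk0]; exact hz)⟩

/-- **UNIQUENESS UP TO SIGN**: `d · δ = d' · δ'` with `δ, δ' ∈ S(H)(K)` forces `d' = d ∨ d' = −d` (`(d⁻¹d') · 1 = δ δ'⁻¹ ∈ S(H)(K)`, and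
`K^× · 1 ∩ S(H)(K) = {±1}`) — the kernel `μ₂` of `𝔾_m × S → L`, «`l ∘ w = −2`». [cite: Milne1999LefschetzClasses, §4 p. 659 L28–L34] -/
theorem Polarization.eq_or_eq_neg_of_smulOfUnit_mul_eq {d d' : Kˣ} {δ δ' : (K ⊗[ℚ] V) ≃ₗ[K] (K ⊗[ℚ] V)}
    (hδ : δ ∈ ψ.lefschetzGroupBaseChange K) (hδ' : δ' ∈ ψ.lefschetzGroupBaseChange K)
    (h : LinearEquiv.smulOfUnit d * δ = LinearEquiv.smulOfUnit d' * δ') : d' = d ∨ d' = -d := by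
  have hmem : LinearEquiv.smulOfUnit (d⁻¹ * d') ∈ ψ.lefschetzGroupBaseChange K := by
    have hcalc : (LinearEquiv.smulOfUnit (d⁻¹ * d') : (K ⊗[ℚ] V) ≃ₗ[K] (K ⊗[ℚ] V)) = δ * δ'⁻¹ := by
      rw [← smulOfUnit_mul_smulOfUnit₅₇₃, eq_mul_inv_iff_mul_eq, mul_assoc, ← h, ← mul_assoc, smulOfUnit_mul_smulOfUnit₅₇₃,
        inv_mul_cancel]
      exact LinearEquiv.ext fun x => one_smul K _
    rw [hcalc]
    exact (ψ.lefschetzGroupBaseChange K).mul_mem hδ ((ψ.lefschetzGroupBaseChange K).inv_mem hδ')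
  rcases (ψ.smulOfUnit_mem_lefschetzGroupBaseChange_iff_eq_or_eq_neg K _).1 hmem with h1 | h1
  · left
    rw [← mul_one d, ← h1, mul_inv_cancel_left]
  · right
    rw [← mul_one d, ← mul_neg, ← h1, mul_inv_cancel_left]

/-! ## §3 The centre: `Z(G(H)(K)) = K^× · Z(S(H)(K))` when the multipliers are squares -/

omit [Nontrivial V] in
/-- **`d · δ` IS CENTRAL IN `G(H)(K)` IFF `δ` IS CENTRAL IN `S(H)(K)`** (`d · 1` is central, g56-#8, and `Z(S) = S ∩ Z(G)`, g56-#8).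
[cite: Milne1999LefschetzClasses, §4 p. 659 L28–L34 and §1 p. 645 L2–L14 (`S₀`)] -/
theorem Polarization.smulOfUnit_mul_mem_center_lefschetzSimilitudeGroupBaseChange_iff (d : Kˣ)
    (δ : ψ.lefschetzGroupBaseChange K) :
    (⟨LinearEquiv.smulOfUnit d * (δ : (K ⊗[ℚ] V) ≃ₗ[K] (K ⊗[ℚ] V)),
        ψ.smulOfUnit_mul_mem_lefschetzSimilitudeGroupBaseChange K d δ.2⟩ : ψ.lefschetzSimilitudeGroupBaseChange K) ∈
      Subgroup.center (ψ.lefschetzSimilitudeGroupBaseChange K) ↔ δ ∈ Subgroup.center (ψ.lefschetzGroupBaseChange K) := by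
  have hmul : (⟨LinearEquiv.smulOfUnit d * (δ : (K ⊗[ℚ] V) ≃ₗ[K] (K ⊗[ℚ] V)),
      ψ.smulOfUnit_mul_mem_lefschetzSimilitudeGroupBaseChange K d δ.2⟩ : ψ.lefschetzSimilitudeGroupBaseChange K) =
      ⟨LinearEquiv.smulOfUnit d, ψ.smulOfUnit_mem_lefschetzSimilitudeGroupBaseChange K d⟩ *
        Subgroup.inclusion (ψ.lefschetzGroupBaseChange_le_lefschetzSimilitudeGroupBaseChange K) δ := rfl
  have hd := ψ.smulOfUnit_mem_center_lefschetzSimilitudeGroupBaseChange K d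
  rw [hmul, ψ.mem_center_lefschetzGroupBaseChange_iff_inclusion_mem_center K δ]
  constructor
  · intro h
    have h' := (Subgroup.center _).mul_mem ((Subgroup.center _).inv_mem hd) h
    rwa [inv_mul_cancel_left] at h'
  · intro h
    exact (Subgroup.center _).mul_mem hd h

/-- **A CENTRAL `γ ∈ G(H)(K)` WITH SQUARE MULTIPLIER IS `d · δ` WITH `δ` CENTRAL IN `S(H)(K)`** — `Z(G(H)(K)) ⊆ K^× · Z(S(H)(K))` on
such elements. [cite: Milne1999LefschetzClasses, §4 p. 659 L28–L34 and §1 p. 645 L2–L14 (`S₀`)] -/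
theorem Polarization.exists_eq_smulOfUnit_mul_of_mem_center_of_isSquare {γ : ψ.lefschetzSimilitudeGroupBaseChange K}
    (hγ : γ ∈ Subgroup.center (ψ.lefschetzSimilitudeGroupBaseChange K)) (hsq : IsSquare (ψ.lefschetzMultiplier K γ)) :
    ∃ (d : Kˣ) (δ : ψ.lefschetzGroupBaseChange K), δ ∈ Subgroup.center (ψ.lefschetzGroupBaseChange K) ∧
      ψ.lefschetzMultiplier K γ = d * d ∧
      (γ : (K ⊗[ℚ] V) ≃ₗ[K] (K ⊗[ℚ] V)) = LinearEquiv.smulOfUnit d * (δ : (K ⊗[ℚ] V) ≃ₗ[K] (K ⊗[ℚ] V)) := by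
  obtain ⟨d, δ, hδ, hl, h⟩ := ψ.exists_eq_smulOfUnit_mul_of_isSquare_lefschetzMultiplier K γ hsq
  refine ⟨d, ⟨δ, hδ⟩, ?_, hl, h⟩
  rw [← ψ.smulOfUnit_mul_mem_center_lefschetzSimilitudeGroupBaseChange_iff K d ⟨δ, hδ⟩]
  have hγ' : (⟨LinearEquiv.smulOfUnit d * δ, ψ.smulOfUnit_mul_mem_lefschetzSimilitudeGroupBaseChange K d hδ⟩ :
      ψ.lefschetzSimilitudeGroupBaseChange K) = γ := Subtype.ext h.symm
  rw [hγ']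
  exact hγ

/-- **`Z(G(H)(K)) = K^× · Z(S(H)(K))` WHEN EVERY UNIT OF `K` IS A SQUARE**: `γ ∈ G(H)(K)` is central iff `γ = d · δ` with `d ∈ K^×` and
`δ ∈ Z(S(H)(K))` (with g55-#8∕g56-#10: in the first kind `Z(S(H)(K)) ≅ {±1}^{t_K}`, so `Z(G(H)(K)) = K^× · {±1}^{t_K}`).
[cite: Milne1999LefschetzClasses, §4 p. 659 L28–L34 and §1 p. 645 L2–L14 (`S₀`)] -/
theorem Polarization.mem_center_lefschetzSimilitudeGroupBaseChange_iff_exists_of_forall_isSquare (hsq : ∀ c : Kˣ, IsSquare c)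
    (γ : ψ.lefschetzSimilitudeGroupBaseChange K) :
    γ ∈ Subgroup.center (ψ.lefschetzSimilitudeGroupBaseChange K) ↔
      ∃ (d : Kˣ) (δ : ψ.lefschetzGroupBaseChange K), δ ∈ Subgroup.center (ψ.lefschetzGroupBaseChange K) ∧
        (γ : (K ⊗[ℚ] V) ≃ₗ[K] (K ⊗[ℚ] V)) = LinearEquiv.smulOfUnit d * (δ : (K ⊗[ℚ] V) ≃ₗ[K] (K ⊗[ℚ] V)) := by
  constructor
  · intro hγ
    obtain ⟨d, δ, hδ, -, h⟩ := ψ.exists_eq_smulOfUnit_mul_of_mem_center_of_isSquare K hγ (hsq _)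
    exact ⟨d, δ, hδ, h⟩
  · rintro ⟨d, δ, hδ, h⟩
    have hγ' : γ = ⟨LinearEquiv.smulOfUnit d * (δ : (K ⊗[ℚ] V) ≃ₗ[K] (K ⊗[ℚ] V)),
        ψ.smulOfUnit_mul_mem_lefschetzSimilitudeGroupBaseChange K d δ.2⟩ := Subtype.ext h
    rw [hγ', ψ.smulOfUnit_mul_mem_center_lefschetzSimilitudeGroupBaseChange_iff K d δ]
    exact hδ

/-- **`Z(G(H)(K̄)) = K̄^× · Z(S(H)(K̄))` OVER AN ALGEBRAICALLY CLOSED FIELD.** [cite: Milne1999LefschetzClasses, §4 p. 659 L28–L34 and §1 p. 645 L2–L14 (`S₀`)] -/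
theorem Polarization.mem_center_lefschetzSimilitudeGroupBaseChange_iff_exists_of_isAlgClosed [IsAlgClosed K]
    (γ : ψ.lefschetzSimilitudeGroupBaseChange K) :
    γ ∈ Subgroup.center (ψ.lefschetzSimilitudeGroupBaseChange K) ↔
      ∃ (d : Kˣ) (δ : ψ.lefschetzGroupBaseChange K), δ ∈ Subgroup.center (ψ.lefschetzGroupBaseChange K) ∧
        (γ : (K ⊗[ℚ] V) ≃ₗ[K] (K ⊗[ℚ] V)) = LinearEquiv.smulOfUnit d * (δ : (K ⊗[ℚ] V) ≃ₗ[K] (K ⊗[ℚ] V)) := by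
  refine ψ.mem_center_lefschetzSimilitudeGroupBaseChange_iff_exists_of_forall_isSquare K (fun c => ?_) γ
  obtain ⟨z, hz⟩ := IsAlgClosed.exists_eq_mul_self (c : K)
  have hz0 : z ≠ 0 := fun h => c.ne_zero (by rw [hz, h, mul_zero])
  exact ⟨Units.mk0 z hz0, Units.ext (by rw [Units.val_mul, Units.val_mk0]; exact hz)⟩

end HodgeStructure

end Literature.AlgebraicGeometry.Motives
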